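import Literature.Probability.Percolation.MarkedLoopLawSlide
import HarnessLib

/-!
# Two single-root pendant attachments at once: the link bookkeeping of the three non-cap cases of the two-cell surgery («PENDANT-TWO-SINGLES»)

Topic `Literature/Probability/Percolation`; a rider on `MarkedLoopLawSlide.lean` §1 (#848: `reachable_union_pendant`, `reachable_union_pendant_root` — ONE pendant edge set `E`
attached through the faces `S` with ONE root `R`). Packaged here for TWO pendants at once — `E₁` through `S₁` rooted at `R₁` and `E₂` through `S₂` rooted at `R₂`, disjoint from
each other and from `ξ` — which is the shape of the three non-cap cases of the lane's TWO-CELL CAP IDENTITY (HOME `FINDING-TWO-CELL-CAP-IDENTITY.md` §2,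
`pub-sawmu-b-engine-2/gen24/DESIGN-next-gen24.md` §2f: the present new bonds form two paths, `a ↦ P` and `b ↦ Q`, or `a ↦ P` and `b ↦ c`, or `a ↦ c` and `b ↦ Q`):

* ★ `reachable_union_two_pendants` — for `X, Y ∉ S₁ ∪ S₂`: `X ~ Y` in `ξ ∪ (E₁ ∪ E₂)` iff in `ξ` (#848's lemma twice: `E₂` over `ξ ∪ E₁`, then `E₁` over `ξ`);
* ★ `reachable_union_two_pendants_root₁` / `_root₂` — a face of `S₁` joined to `R₁` inside `E₁` is linked to `Y ∉ S₁ ∪ S₂` iff `R₁ ~ Y` in `ξ` (and symmetrically);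
* ★ `reachable_union_two_pendants_roots` — a face of `S₁` joined to `R₁` and a face of `S₂` joined to `R₂` are linked iff `R₁ ~ R₂` in `ξ`.

## References
* M. Khristoforov, S. Smirnov, *Percolation and O(1) loop model*, arXiv:2111.15612v1 (2021), §1.2 (p. 2: «IP(ξ) is a union of disjoint paths, matching marked points»).
* P. A. Pearce, V. Rittenberg, J. de Gier, B. Nienhuis, *Temperley–Lieb stochastic processes*, J. Phys. A 35 (2002) L661–L668, §2 (link patterns).

## Mathlib / tree
Tree: `MarkedLoopLawSlide` (`reachable_union_pendant`, `reachable_union_pendant_root`), `FiveMarkedLoops` / `FivePointNormalisation` (`side`, `sideGraph`). Mathlib: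
`SimpleGraph.Reachable`, `Finset.disjoint_union_left/right`, `Finset.union_assoc`.
-/

open Finset

namespace Literature.Probability.Percolation.MarkedLoops

open Literature.Probability.Percolation Literature.Probability.LatticeModels
open Literature.Probability.Percolation.FivePoint (side)
open Literature.Probability.Percolation.FivePoint.N5 (sideGraph)

section TwoSingles

variable {ξ E₁ E₂ : Finset (Sym2 (Site 2))} {S₁ S₂ : Finset HexVertex} {R₁ R₂ : HexVertex}

/-- **TWO DISJOINT SINGLE-ROOT PENDANTS**: the hypotheses. [cite: KhristoforovSmirnov2021, §1.2 (arXiv v1 p. 2: `IP(ξ)` is a union of disjoint paths)] -/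
structure TwoPendants (ξ E₁ E₂ : Finset (Sym2 (Site 2))) (S₁ S₂ : Finset HexVertex) (R₁ R₂ : HexVertex) : Prop where
  /-- every side of a face of `S₁` lying in `ξ ∪ (E₁ ∪ E₂)` lies in `E₁` -/
  sides₁ : ∀ F ∈ S₁, ∀ j : Fin 3, side F j ∈ ξ ∪ (E₁ ∪ E₂) → side F j ∈ E₁
  /-- every side of a face of `S₂` lying in `ξ ∪ (E₁ ∪ E₂)` lies in `E₂` -/
  sides₂ : ∀ F ∈ S₂, ∀ j : Fin 3, side F j ∈ ξ ∪ (E₁ ∪ E₂) → side F j ∈ E₂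
  /-- faces off `S₁ ∪ {R₁}` have no side in `E₁` -/
  root₁ : ∀ F, F ∉ S₁ → F ≠ R₁ → ∀ j : Fin 3, side F j ∉ E₁
  /-- faces off `S₂ ∪ {R₂}` have no side in `E₂` -/
  root₂ : ∀ F, F ∉ S₂ → F ≠ R₂ → ∀ j : Fin 3, side F j ∉ E₂
  /-- disjointness -/
  disj₁ : Disjoint ξ E₁
  /-- disjointness -/
  disj₂ : Disjoint ξ E₂
  /-- disjointness -/
  disj₁₂ : Disjoint E₁ E₂
  /-- the two face sets are disjoint -/
  disjS : Disjoint S₁ S₂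
  /-- the roots are off the face sets -/
  R₁_notMem : R₁ ∉ S₁ ∪ S₂
  /-- the roots are off the face sets -/
  R₂_notMem : R₂ ∉ S₁ ∪ S₂

namespace TwoPendants

variable (T : TwoPendants ξ E₁ E₂ S₁ S₂ R₁ R₂)
include T

/-- the pendant hypotheses of #848 §1 for `E₂` over `ξ ∪ E₁`. [cite: KhristoforovSmirnov2021, §1.2 (arXiv v1 p. 2)] -/
theorem pendant₂ : (∀ F ∈ S₂, ∀ j : Fin 3, side F j ∈ (ξ ∪ E₁) ∪ E₂ → side F j ∈ E₂) ∧ Disjoint (ξ ∪ E₁) E₂ :=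
  ⟨fun F hF j hj => T.sides₂ F hF j (by rwa [Finset.union_assoc] at hj), Finset.disjoint_union_left.2 ⟨T.disj₂, T.disj₁₂⟩⟩

/-- the pendant hypotheses of #848 §1 for `E₁` over `ξ`. [cite: KhristoforovSmirnov2021, §1.2 (arXiv v1 p. 2)] -/
theorem pendant₁ : ∀ F ∈ S₁, ∀ j : Fin 3, side F j ∈ ξ ∪ E₁ → side F j ∈ E₁ :=
  fun F hF j hj => T.sides₁ F hF j (by
    rcases Finset.mem_union.1 hj with h | h
    · exact Finset.mem_union_left _ h
    · exact Finset.mem_union_right _ (Finset.mem_union_left _ h))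

/-- ★ **TWO PENDANTS CHANGE NO LINK OFF `S₁ ∪ S₂`.** [cite: KhristoforovSmirnov2021, §1.2 (arXiv v1 p. 2: `IP(ξ)` is a union of disjoint paths)] -/
theorem reachable_union_two_pendants {X Y : HexVertex} (hX : X ∉ S₁ ∪ S₂) (hY : Y ∉ S₁ ∪ S₂) :
    (sideGraph (ξ ∪ (E₁ ∪ E₂))).Reachable X Y ↔ (sideGraph ξ).Reachable X Y := by
  rw [Finset.mem_union, not_or] at hX hY
  rw [← Finset.union_assoc, reachable_union_pendant T.pendant₂.1 T.root₂ T.pendant₂.2 hX.2 hY.2]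
  exact reachable_union_pendant T.pendant₁ T.root₁ T.disj₁ hX.1 hY.1

/-- ★ **a face of `S₁` joined to `R₁` is linked to `Y ∉ S₁ ∪ S₂` iff `R₁ ~ Y` in `ξ`.** [cite: KhristoforovSmirnov2021, §1.2 (arXiv v1 p. 2: `IP(ξ)` is a union of disjoint paths)] -/
theorem reachable_union_two_pendants_root₁ {A Y : HexVertex} (hA : A ∈ S₁) (hAR : (sideGraph E₁).Reachable A R₁) (hY : Y ∉ S₁ ∪ S₂) :
    (sideGraph (ξ ∪ (E₁ ∪ E₂))).Reachable A Y ↔ (sideGraph ξ).Reachable R₁ Y := by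
  rw [Finset.mem_union, not_or] at hY
  have hA₂ : A ∉ S₂ := fun h => Finset.disjoint_left.1 T.disjS hA h
  have hR₁ : R₁ ∉ S₁ := fun h => T.R₁_notMem (Finset.mem_union_left _ h)
  rw [← Finset.union_assoc, reachable_union_pendant T.pendant₂.1 T.root₂ T.pendant₂.2 hA₂ hY.2]
  exact reachable_union_pendant_root T.pendant₁ T.root₁ T.disj₁ hA hY.1 hAR

/-- ★ **a face of `S₂` joined to `R₂` is linked to `Y ∉ S₁ ∪ S₂` iff `R₂ ~ Y` in `ξ`.** [cite: KhristoforovSmirnov2021, §1.2 (arXiv v1 p. 2: `IP(ξ)` is a union of disjoint paths)] -/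
theorem reachable_union_two_pendants_root₂ {B Y : HexVertex} (hB : B ∈ S₂) (hBR : (sideGraph E₂).Reachable B R₂) (hY : Y ∉ S₁ ∪ S₂) :
    (sideGraph (ξ ∪ (E₁ ∪ E₂))).Reachable B Y ↔ (sideGraph ξ).Reachable R₂ Y := by
  rw [Finset.mem_union, not_or] at hY
  have hR₂ : R₂ ∉ S₁ := fun h => T.R₂_notMem (Finset.mem_union_left _ h)
  rw [← Finset.union_assoc, reachable_union_pendant_root T.pendant₂.1 T.root₂ T.pendant₂.2 hB hY.2 hBR]
  exact reachable_union_pendant T.pendant₁ T.root₁ T.disj₁ hR₂ hY.1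

/-- ★ **a face of `S₁` joined to `R₁` and a face of `S₂` joined to `R₂` are linked iff `R₁ ~ R₂` in `ξ`.**
[cite: KhristoforovSmirnov2021, §1.2 (arXiv v1 p. 2: `IP(ξ)` is a union of disjoint paths)] -/
theorem reachable_union_two_pendants_roots {A B : HexVertex} (hA : A ∈ S₁) (hAR : (sideGraph E₁).Reachable A R₁) (hB : B ∈ S₂)
    (hBR : (sideGraph E₂).Reachable B R₂) : (sideGraph (ξ ∪ (E₁ ∪ E₂))).Reachable A B ↔ (sideGraph ξ).Reachable R₁ R₂ := by
  have hA₂ : A ∉ S₂ := fun h => Finset.disjoint_left.1 T.disjS hA h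
  have hR₂ : R₂ ∉ S₁ := fun h => T.R₂_notMem (Finset.mem_union_left _ h)
  rw [SimpleGraph.reachable_comm, ← Finset.union_assoc, reachable_union_pendant_root T.pendant₂.1 T.root₂ T.pendant₂.2 hB hA₂ hBR, SimpleGraph.reachable_comm,
    reachable_union_pendant_root T.pendant₁ T.root₁ T.disj₁ hA hR₂ hAR]

end TwoPendants

end TwoSingles

end Literature.Probability.Percolation.MarkedLoops
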